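import Literature.Analysis.FluidPDE.PassiveScalarDiagMildBounds
import Literature.Analysis.FluidPDE.PassiveScalarDiagMildCoeff
import HarnessLib

/-!
# Mild (Duhamel) formulation of the passive scalar equation with constant diagonal diffusion and
  bounded drift: the Picard iteration with a general free term

Analysis/FluidPDE proof-support file (everything proved). The Picard iteration of
`PassiveScalarDiagMildFixedPoint` (Pazy 1983, Ch. 6 Thm. 1.2: mild solutions by successive
approximation) made ABSTRACT in the free term: for the data `Torus.PicardData` (horizon `T > 0`,
`κ > 0`, `aᵢ > 0`, drift bounded by `U`, damping `λ > 0` with `(∑ⱼaⱼ⁻¹)U²/(2κλ) ≤ 1/4`, and an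
admissible coefficient family `f` on `[0,T]` with finite `ℓ²` norms bounded by `A` — the FREE TERM)
the map `Φ(w)(t)(k) = f(t)(k) - D^λ(w)(t)(k)` (`D^λ` the damped Duhamel coefficient of `div(uw)`,
`Torus.duhamelCoeff`) preserves the ball of radius `R = 2A` (`A + R/2 = R`) and contracts by `1/2`;
the iterates converge to an admissible family whose synthesized field `w` is a fixed point
`𝓕(w(t))(k) = f(t)(k) - D^λ(w)(t)(k)` on `[0,T]` (`PicardData.exists_fixedPoint`).

The unforced problem is the free term `f(t)(k) = e^{-(νₖ+λ)t} θ̂₀(k)`; the FORCED problem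
`∂ₜθ + div(uθ) = κ∑ᵢaᵢ∂ᵢ∂ᵢθ + s` adds the source Duhamel term `∫₀ᵗ e^{-(νₖ+λ)(t-τ)} ŝ(τ)(k) dτ`
(sequel files `PassiveScalarDiagMildSource`, `PassiveScalarDiagForcedExistence`).

## References

* A. Pazy, *Semigroups of Linear Operators and Applications to PDE*, Springer 1983, Ch. 4 §4.2
  (mild solutions, (2.3), Def. 2.3, inhomogeneous problem Cor. 2.5), Ch. 6 §6.1 Thm. 1.2 (Picard iteration).
* L. Grafakos, *Classical Fourier Analysis*, 3rd ed. (2014), Prop. 3.2.6 (4), Prop. 3.2.7 (3).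
* J. C. Robinson, J. L. Rodrigo, W. Sadowski, *The Three-Dimensional Navier–Stokes Equations* (2016), Thm. 4.11.
-/

noncomputable section

open MeasureTheory TopologicalSpace Set Function Filter UnitAddTorus
open _root_.Topology
open scoped ENNReal NNReal InnerProductSpace ComplexConjugate

namespace Literature.Analysis.FluidPDE

namespace Torus

open Literature.Analysis.FunctionSpaces.Torus Literature.Analysis.FunctionSpaces

variable {d : Type*} [Fintype d]

section Picard

/-- **The data of the Picard iteration with a general free term**: the horizon `T > 0`,
diffusivity `κ > 0`, coefficients `aᵢ > 0`, a drift bounded by `U` on `(0,T) × T^d`, a damping rate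
`λ > 0` with contraction constant `q² = (∑ⱼaⱼ⁻¹)U²/(2κλ) ≤ 1/4`, and an admissible coefficient
family `f` on `[0,T]` (continuous coordinates, finite `ℓ²` norms bounded by `A`, conjugate
symmetric) — the free term of the mild equation `ĉ = f - D^λ(c)` (for the inhomogeneous problem
`f` = damped heat flow of the datum + Duhamel integral of the source, Pazy 1983, Ch. 4 Cor. 2.5).
[cite: Pazy1983, Ch. 6 §6.1 Thm. 1.2 (proof: Picard iteration), p. 184] -/
structure PicardData (d : Type*) [Fintype d] where
  /-- the horizon -/
  T : ℝ
  /-- the diffusivity -/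
  κ : ℝ
  /-- the damping rate -/
  lam : ℝ
  /-- the drift bound -/
  U : ℝ
  /-- the diffusion coefficients -/
  a : d → ℝ
  /-- the drift -/
  u : ℝ → UnitAddTorus d → EuclideanSpace ℝ d
  /-- the free term -/
  f : ℝ → (d → ℤ) → ℂ
  /-- the bound of the free term -/
  Af : ℝ
  /-- `T > 0` -/
  hT : 0 < T
  /-- `κ > 0` -/
  hκ : 0 < κ
  /-- `λ > 0` -/
  hlam : 0 < lam
  /-- `aᵢ > 0` -/
  ha : ∀ i, 0 < a i
  /-- the drift is bounded by `U` a.e. on `(0,T) × T^d` -/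
  hu : DriftBound T u U
  /-- the free term is admissible with bound `A` -/
  hf : IsMildCoeff T Af f
  /-- the contraction constant is at most `1/2` -/
  hq : (∑ j, (a j)⁻¹) * U ^ 2 / (2 * κ * lam) ≤ 1 / 4

namespace PicardData

variable [DecidableEq d] [Nonempty d] (Q : PicardData d)

/-- The invariant bound of the iteration, `R = 2A`. [cite: Pazy1983, Ch. 6 §6.1 Thm. 1.2 (proof: Picard iteration), p. 184] -/
def R : ℝ := 2 * Q.Af

omit [DecidableEq d] [Nonempty d] in
/-- `A ≥ 0`. [cite: Pazy1983, Ch. 6 §6.1 Thm. 1.2 (proof: Picard iteration), p. 184] -/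
theorem Af_nonneg : 0 ≤ Q.Af := Q.hf.nonneg Q.hT.le

omit [DecidableEq d] [Nonempty d] in
/-- `R ≥ 0`. [cite: Pazy1983, Ch. 6 §6.1 Thm. 1.2 (proof: Picard iteration), p. 184] -/
theorem R_nonneg : 0 ≤ Q.R := mul_nonneg zero_le_two Q.Af_nonneg

/-- **The Picard map** `Φ(w)(t)(k) = f(t)(k) - D^λ(w)(t)(k)`. [cite: Pazy1983, Ch. 4 §4.2, (2.3) and Def. 2.3 (mild solution), p. 106] -/
def picardMap (w : ℝ → UnitAddTorus d → ℝ) (t : ℝ) (k : d → ℤ) : ℂ :=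
  Q.f t k - duhamelCoeff Q.κ Q.a Q.lam Q.u w t k

omit [DecidableEq d] [Nonempty d] in
/-- Unfolding `picardMap`. [cite: Pazy1983, Ch. 4 §4.2, (2.3) and Def. 2.3 (mild solution), p. 106] -/
theorem picardMap_apply (w : ℝ → UnitAddTorus d → ℝ) (t : ℝ) (k : d → ℤ) :
    Q.picardMap w t k = Q.f t k - duhamelCoeff Q.κ Q.a Q.lam Q.u w t k := rfl

omit [DecidableEq d] [Nonempty d] in
/-- **The Duhamel part contracts by `1/2`**: for a field with `∫ w(t)² ≤ δ²` on `[0,T]`,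
`l2F F (D^λ(w)(t)) ≤ δ/2` (the contraction bound `sum_norm_sq_duhamelCoeff_le_const` and `q ≤ 1/2`). [cite: Pazy1983, Ch. 6 §6.1 Thm. 1.2 (proof: Picard iteration), p. 184] -/
theorem l2F_duhamel_le_half {δ : ℝ} (hδ : 0 ≤ δ) {w : ℝ → UnitAddTorus d → ℝ} (hw : IsL2Field Q.T (δ ^ 2) w)
    {t : ℝ} (ht : t ∈ Icc 0 Q.T) (F : Finset (d → ℤ)) :
    l2F F (duhamelCoeff Q.κ Q.a Q.lam Q.u w t) ≤ δ / 2 := by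
  rw [l2F_le_iff (by positivity)]
  refine (sum_norm_sq_duhamelCoeff_le_const Q.hu hw Q.ha Q.hκ Q.hlam ht F).trans ?_
  have h := Q.hq
  have hκl : 0 < 2 * Q.κ * Q.lam := by have := Q.hκ; have := Q.hlam; positivity
  rw [div_le_iff₀ hκl] at h ⊢
  have hδ2 : 0 ≤ δ ^ 2 := sq_nonneg _
  calc (∑ j, (Q.a j)⁻¹) * Q.U ^ 2 * δ ^ 2 = ((∑ j, (Q.a j)⁻¹) * Q.U ^ 2) * δ ^ 2 := by ring
    _ ≤ (1 / 4 * (2 * Q.κ * Q.lam)) * δ ^ 2 := mul_le_mul_of_nonneg_right h hδ2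
    _ = (δ / 2) ^ 2 * (2 * Q.κ * Q.lam) := by ring

omit [DecidableEq d] [Nonempty d] in
/-- **The Picard map preserves the invariant ball**: for a field with `∫ w(t)² ≤ B²` on `[0,T]`,
`Φ(w)` is an admissible family with bound `R` (`A + R/2 = R`). [cite: Pazy1983, Ch. 6 §6.1 Thm. 1.2 (proof: Picard iteration), p. 184] -/
theorem isMildCoeff_picardMap {w : ℝ → UnitAddTorus d → ℝ} (hw : IsL2Field Q.T (Q.R ^ 2) w) :
    IsMildCoeff Q.T Q.R (Q.picardMap w) := by
  refine ⟨fun k => (Q.hf.continuousOn k).sub (continuousOn_duhamelCoeff Q.hu hw k), fun t ht F => ?_,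
    fun t ht k => ?_⟩
  · have h1 := Q.hf.l2F_le t ht F
    have h2 := Q.l2F_duhamel_le_half Q.R_nonneg hw ht F
    have h := l2F_sub_le F (Q.f t) (duhamelCoeff Q.κ Q.a Q.lam Q.u w t)
    calc l2F F (Q.picardMap w t) ≤ Q.Af + Q.R / 2 := h.trans (add_le_add h1 h2)
      _ = Q.R := by rw [R]; ring
  · rw [picardMap_apply, picardMap_apply, map_sub, Q.hf.symm t ht k, duhamelCoeff_neg]

omit [DecidableEq d] [Nonempty d] in
/-- The zeroth iterate `Φ(0) = f` is admissible with the invariant bound. [cite: Pazy1983, Ch. 6 §6.1 Thm. 1.2 (proof: Picard iteration), p. 184] -/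
theorem isMildCoeff_zero : IsMildCoeff Q.T Q.R (Q.picardMap fun _ _ => (0 : ℝ)) :=
  Q.isMildCoeff_picardMap (IsL2Field.zero Q.T (sq_nonneg _))

/-- **An iterate**: an admissible coefficient family with the invariant bound. [cite: Pazy1983, Ch. 6 §6.1 Thm. 1.2 (proof: Picard iteration), p. 184] -/
structure Stage where
  /-- the coefficient family -/
  coef : ℝ → (d → ℤ) → ℂ
  /-- admissibility -/
  hcoef : IsMildCoeff Q.T Q.R coef

namespace Stage

variable {Q}
variable (I : Q.Stage)

/-- The synthesized field of a stage (a choice). [cite: RobinsonRodrigoSadowski2016, Thm. 4.11] -/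
def synth : ℝ → UnitAddTorus d → ℝ := Classical.choose (I.hcoef.exists_field Q.hT.le)

/-- The synthesized field is an `L^∞_t L²_x` field with the invariant bound. [cite: RobinsonRodrigoSadowski2016, Thm. 4.11] -/
theorem isL2Field_synth : IsL2Field Q.T (Q.R ^ 2) I.synth :=
  (Classical.choose_spec (I.hcoef.exists_field Q.hT.le)).1

/-- The synthesized field has the prescribed Fourier coefficients on `[0,T]`. [cite: RobinsonRodrigoSadowski2016, Thm. 4.11] -/
theorem mFourierCoeff_synth {t : ℝ} (ht : t ∈ Icc 0 Q.T) (k : d → ℤ) :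
    mFourierCoeff (fun x => (I.synth t x : ℂ)) k = I.coef t k :=
  (Classical.choose_spec (I.hcoef.exists_field Q.hT.le)).2 t ht k

/-- **The Picard step** `I ↦ Φ(synth I)`. [cite: Pazy1983, Ch. 6 §6.1 Thm. 1.2 (proof: Picard iteration), p. 184] -/
def step : Q.Stage :=
  ⟨Q.picardMap I.synth, Q.isMildCoeff_picardMap I.isL2Field_synth⟩

end Stage

/-- **The Picard iterates** `c₀ = Φ(0)`, `cₙ₊₁ = Φ(wₙ)` with `wₙ` the synthesized field of `cₙ`. [cite: Pazy1983, Ch. 6 §6.1 Thm. 1.2 (proof: Picard iteration), p. 184] -/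
def stage : ℕ → Q.Stage
  | 0 => ⟨_, Q.isMildCoeff_zero⟩
  | n + 1 => (stage n).step

/-- Unfolding the zeroth iterate. [cite: Pazy1983, Ch. 6 §6.1 Thm. 1.2 (proof: Picard iteration), p. 184] -/
theorem stage_zero_coef : (Q.stage 0).coef = Q.picardMap fun _ _ => (0 : ℝ) := rfl

/-- Unfolding the successor iterate. [cite: Pazy1983, Ch. 6 §6.1 Thm. 1.2 (proof: Picard iteration), p. 184] -/
theorem stage_succ_coef (n : ℕ) : (Q.stage (n + 1)).coef = Q.picardMap (Q.stage n).synth := rfl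

/-- **Geometric decay of consecutive differences**:
`l2F F (cₙ₊₁(t) - cₙ(t)) ≤ R (1/2)^{n+1}` on `[0,T]`. [cite: Pazy1983, Ch. 6 §6.1 Thm. 1.2 (proof: Picard iteration), p. 184] -/
theorem l2F_stage_succ_sub_le (n : ℕ) {t : ℝ} (ht : t ∈ Icc 0 Q.T) (F : Finset (d → ℤ)) :
    l2F F (fun k => (Q.stage (n + 1)).coef t k - (Q.stage n).coef t k) ≤ Q.R * (1 / 2) ^ (n + 1) := by
  induction n generalizing t F with
  | zero =>
    have hw₀ := (Q.stage 0).isL2Field_synth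
    have e : (fun k => (Q.stage 1).coef t k - (Q.stage 0).coef t k) =
        fun k => -(duhamelCoeff Q.κ Q.a Q.lam Q.u (Q.stage 0).synth t k) := by
      funext k
      rw [Q.stage_succ_coef 0, stage_zero_coef, picardMap_apply, picardMap_apply, duhamelCoeff_zero_field]
      simp
    rw [e]
    have e2 : l2F F (fun k => -duhamelCoeff Q.κ Q.a Q.lam Q.u (Q.stage 0).synth t k) =
        l2F F (duhamelCoeff Q.κ Q.a Q.lam Q.u (Q.stage 0).synth t) := by
      simp only [l2F_apply, norm_neg]
    rw [e2, zero_add, pow_one, mul_one_div]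
    exact Q.l2F_duhamel_le_half Q.R_nonneg hw₀ ht F
  | succ n ih =>
    have hδ : 0 ≤ Q.R * (1 / 2) ^ (n + 1) := by have := Q.R_nonneg; positivity
    have hdiff : IsL2Field Q.T ((Q.R * (1 / 2) ^ (n + 1)) ^ 2)
        (fun s x => (Q.stage (n + 1)).synth s x - (Q.stage n).synth s x) :=
      (Q.stage (n + 1)).isL2Field_synth.sub_of_coeff (Q.stage n).isL2Field_synth
        (fun s hs k => (Q.stage (n + 1)).mFourierCoeff_synth hs k)
        (fun s hs k => (Q.stage n).mFourierCoeff_synth hs k) hδ (fun s hs G => ih hs G)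
    have e : (fun k => (Q.stage (n + 1 + 1)).coef t k - (Q.stage (n + 1)).coef t k) =
        fun k => -(duhamelCoeff Q.κ Q.a Q.lam Q.u
          (fun s x => (Q.stage (n + 1)).synth s x - (Q.stage n).synth s x) t k) := by
      funext k
      rw [Q.stage_succ_coef (n + 1), Q.stage_succ_coef n, picardMap_apply, picardMap_apply,
        duhamelCoeff_sub Q.hu (Q.stage (n + 1)).isL2Field_synth (Q.stage n).isL2Field_synth ht.2]
      ring
    rw [e]
    have e2 : l2F F (fun k => -duhamelCoeff Q.κ Q.a Q.lam Q.u
          (fun s x => (Q.stage (n + 1)).synth s x - (Q.stage n).synth s x) t k) =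
        l2F F (duhamelCoeff Q.κ Q.a Q.lam Q.u
          (fun s x => (Q.stage (n + 1)).synth s x - (Q.stage n).synth s x) t) := by
      simp only [l2F_apply, norm_neg]
    rw [e2]
    calc l2F F (duhamelCoeff Q.κ Q.a Q.lam Q.u
          (fun s x => (Q.stage (n + 1)).synth s x - (Q.stage n).synth s x) t)
        ≤ Q.R * (1 / 2) ^ (n + 1) / 2 := Q.l2F_duhamel_le_half hδ hdiff ht F
      _ = Q.R * (1 / 2) ^ (n + 1 + 1) := by ring

/-- **The iterates are Cauchy, uniformly on `[0,T]` and in the frequency set**: for `n ≤ m`,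
`l2F F (cₘ(t) - cₙ(t)) ≤ R (1/2)^n - R (1/2)^m`. [cite: Pazy1983, Ch. 6 §6.1 Thm. 1.2 (proof: Picard iteration), p. 184] -/
theorem l2F_stage_sub_le {n m : ℕ} (hnm : n ≤ m) {t : ℝ} (ht : t ∈ Icc 0 Q.T) (F : Finset (d → ℤ)) :
    l2F F (fun k => (Q.stage m).coef t k - (Q.stage n).coef t k) ≤ Q.R * (1 / 2) ^ n - Q.R * (1 / 2) ^ m := by
  induction m, hnm using Nat.le_induction with
  | base =>
    have : l2F F (fun k => (Q.stage n).coef t k - (Q.stage n).coef t k) = 0 := by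
      simp [l2F_apply]
    rw [this, sub_self]
  | succ m hnm ih =>
    have h1 := Q.l2F_stage_succ_sub_le m ht F
    calc l2F F (fun k => (Q.stage (m + 1)).coef t k - (Q.stage n).coef t k)
        ≤ Q.R * (1 / 2) ^ (m + 1) + (Q.R * (1 / 2) ^ n - Q.R * (1 / 2) ^ m) := l2F_sub_le_of_le h1 ih
      _ = Q.R * (1 / 2) ^ n - Q.R * (1 / 2) ^ (m + 1) := by ring

/-- Coordinatewise Cauchy bound: `‖cₘ(t)(k) - cₙ(t)(k)‖ ≤ R (1/2)^n` for `n ≤ m`, `t ∈ [0,T]`. [cite: Pazy1983, Ch. 6 §6.1 Thm. 1.2 (proof: Picard iteration), p. 184] -/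
theorem norm_stage_sub_le {n m : ℕ} (hnm : n ≤ m) {t : ℝ} (ht : t ∈ Icc 0 Q.T) (k : d → ℤ) :
    ‖(Q.stage m).coef t k - (Q.stage n).coef t k‖ ≤ Q.R * (1 / 2) ^ n := by
  have h := Q.l2F_stage_sub_le hnm ht {k}
  have h0 : 0 ≤ Q.R * (1 / 2) ^ m := by have := Q.R_nonneg; positivity
  exact (norm_le_l2F (Finset.mem_singleton_self k) (fun k => (Q.stage m).coef t k - (Q.stage n).coef t k)).trans
    (h.trans (by linarith))

omit [DecidableEq d] [Nonempty d] in
/-- The geometric majorant tends to `0`. [cite: Pazy1983, Ch. 6 §6.1 Thm. 1.2 (proof: Picard iteration), p. 184] -/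
theorem tendsto_R_mul_pow : Tendsto (fun n : ℕ => Q.R * (1 / 2) ^ n) atTop (𝓝 0) := by
  have h := (tendsto_pow_atTop_nhds_zero_of_lt_one (by norm_num : (0 : ℝ) ≤ 1 / 2)
    (by norm_num : (1 : ℝ) / 2 < 1)).const_mul Q.R
  rwa [mul_zero] at h

omit [DecidableEq d] [Nonempty d] in
/-- A geometric threshold: `R (1/2)^N < ε` for some `N`. [cite: Pazy1983, Ch. 6 §6.1 Thm. 1.2 (proof: Picard iteration), p. 184] -/
theorem exists_R_mul_pow_lt {ε : ℝ} (hε : 0 < ε) : ∃ N : ℕ, Q.R * (1 / 2) ^ N < ε :=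
  (Q.tendsto_R_mul_pow.eventually (gt_mem_nhds hε)).exists

/-- **The iterates converge coordinatewise** on `[0,T]` (Cauchy in `ℂ`). [cite: Pazy1983, Ch. 6 §6.1 Thm. 1.2 (proof: Picard iteration), p. 184] -/
theorem cauchySeq_stage {t : ℝ} (ht : t ∈ Icc 0 Q.T) (k : d → ℤ) : CauchySeq fun n => (Q.stage n).coef t k := by
  refine Metric.cauchySeq_iff'.2 fun ε hε => ?_
  obtain ⟨N, hN⟩ := Q.exists_R_mul_pow_lt hε
  refine ⟨N, fun n hn => ?_⟩
  rw [dist_eq_norm]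
  exact (Q.norm_stage_sub_le hn ht k).trans_lt hN

/-- **The limit family** `c_∞(t)(k) = limₙ cₙ(t)(k)` (meaningful for `t ∈ [0,T]`). [cite: Pazy1983, Ch. 6 §6.1 Thm. 1.2 (proof: Picard iteration), p. 184] -/
def limFamily : ℝ → (d → ℤ) → ℂ := fun t k => limUnder atTop fun n => (Q.stage n).coef t k

/-- The iterates converge to the limit family on `[0,T]`. [cite: Pazy1983, Ch. 6 §6.1 Thm. 1.2 (proof: Picard iteration), p. 184] -/
theorem tendsto_limFamily {t : ℝ} (ht : t ∈ Icc 0 Q.T) (k : d → ℤ) :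
    Tendsto (fun n => (Q.stage n).coef t k) atTop (𝓝 (Q.limFamily t k)) :=
  tendsto_nhds_limUnder (cauchySeq_tendsto_of_complete (Q.cauchySeq_stage ht k))

/-- **Rate of convergence in the finite `ℓ²` norms**: `l2F F (c_∞(t) - cₙ(t)) ≤ R (1/2)^n`,
uniformly in `t ∈ [0,T]` and `F`. [cite: Pazy1983, Ch. 6 §6.1 Thm. 1.2 (proof: Picard iteration), p. 184] -/
theorem l2F_limFamily_sub_le (n : ℕ) {t : ℝ} (ht : t ∈ Icc 0 Q.T) (F : Finset (d → ℤ)) :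
    l2F F (fun k => Q.limFamily t k - (Q.stage n).coef t k) ≤ Q.R * (1 / 2) ^ n := by
  have h : Tendsto (fun m => l2F F fun k => (Q.stage m).coef t k - (Q.stage n).coef t k) atTop
      (𝓝 (l2F F fun k => Q.limFamily t k - (Q.stage n).coef t k)) := by
    simp only [l2F_apply]
    refine (Real.continuous_sqrt.tendsto _).comp (tendsto_finsetSum _ fun k _ => ?_)
    exact (((Q.tendsto_limFamily ht k).sub tendsto_const_nhds).norm).pow 2
  refine le_of_tendsto h (eventually_atTop.2 ⟨n, fun m hm => ?_⟩)
  have h0 : 0 ≤ Q.R * (1 / 2) ^ m := by have := Q.R_nonneg; positivity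
  linarith [Q.l2F_stage_sub_le hm ht F]

/-- The limit family obeys the invariant bound: `l2F F (c_∞(t)) ≤ R` on `[0,T]`. [cite: Pazy1983, Ch. 6 §6.1 Thm. 1.2 (proof: Picard iteration), p. 184] -/
theorem l2F_limFamily_le {t : ℝ} (ht : t ∈ Icc 0 Q.T) (F : Finset (d → ℤ)) : l2F F (Q.limFamily t) ≤ Q.R := by
  have h : Tendsto (fun m => l2F F ((Q.stage m).coef t)) atTop (𝓝 (l2F F (Q.limFamily t))) := by
    simp only [l2F_apply]
    refine (Real.continuous_sqrt.tendsto _).comp (tendsto_finsetSum _ fun k _ => ?_)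
    exact ((Q.tendsto_limFamily ht k).norm).pow 2
  exact le_of_tendsto' h fun m => (Q.stage m).hcoef.l2F_le t ht F

/-- The limit family is conjugate symmetric on `[0,T]`. [cite: Grafakos2014, Prop. 3.2.6 (4)] -/
theorem limFamily_symm {t : ℝ} (ht : t ∈ Icc 0 Q.T) (k : d → ℤ) : Q.limFamily t (-k) = conj (Q.limFamily t k) := by
  have h1 := Q.tendsto_limFamily ht (-k)
  have h2 : Tendsto (fun n => conj ((Q.stage n).coef t k)) atTop (𝓝 (conj (Q.limFamily t k))) :=
    (Complex.continuous_conj.tendsto _).comp (Q.tendsto_limFamily ht k)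
  exact tendsto_nhds_unique h1 (h2.congr fun n => ((Q.stage n).hcoef.symm t ht k).symm)

/-- **The limit family is continuous in time** on `[0,T]` at every frequency (uniform limit of
continuous functions). [cite: Pazy1983, Ch. 6 §6.1 Thm. 1.2 (proof: Picard iteration), p. 184] -/
theorem continuousOn_limFamily (k : d → ℤ) : ContinuousOn (fun t => Q.limFamily t k) (Icc 0 Q.T) := by
  have hU : TendstoUniformlyOn (fun n t => (Q.stage n).coef t k) (fun t => Q.limFamily t k) atTop (Icc 0 Q.T) := by
    refine Metric.tendstoUniformlyOn_iff.2 fun ε hε => ?_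
    obtain ⟨N, hN⟩ := Q.exists_R_mul_pow_lt hε
    refine eventually_atTop.2 ⟨N, fun n hn t ht => ?_⟩
    rw [dist_eq_norm]
    have h1 := norm_le_l2F (Finset.mem_singleton_self k) (fun k => Q.limFamily t k - (Q.stage n).coef t k)
    have h2 := Q.l2F_limFamily_sub_le n ht {k}
    have h3 : Q.R * (1 / 2) ^ n ≤ Q.R * (1 / 2) ^ N :=
      mul_le_mul_of_nonneg_left (pow_le_pow_of_le_one (by norm_num) (by norm_num) hn) Q.R_nonneg
    exact (h1.trans (h2.trans h3)).trans_lt hN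
  exact hU.continuousOn (Eventually.of_forall fun n => (Q.stage n).hcoef.continuousOn k).frequently

/-- The limit family is admissible with the invariant bound. [cite: Pazy1983, Ch. 6 §6.1 Thm. 1.2 (proof: Picard iteration), p. 184] -/
theorem isMildCoeff_limFamily : IsMildCoeff Q.T Q.R Q.limFamily :=
  ⟨Q.continuousOn_limFamily, fun _ ht F => Q.l2F_limFamily_le ht F, fun _ ht k => Q.limFamily_symm ht k⟩

/-- The limit iterate. [cite: Pazy1983, Ch. 6 §6.1 Thm. 1.2 (proof: Picard iteration), p. 184] -/
def limStage : Q.Stage := ⟨Q.limFamily, Q.isMildCoeff_limFamily⟩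

/-- The coefficients of the limit iterate are the limit family. [cite: Pazy1983, Ch. 6 §6.1 Thm. 1.2 (proof: Picard iteration), p. 184] -/
theorem limStage_coef : Q.limStage.coef = Q.limFamily := rfl

/-- **The fixed point.** The synthesized field `w` of the limit family satisfies
`𝓕(w(t))(k) = c_∞(t)(k) = f(t)(k) - D^λ(w)(t)(k)` for all `t ∈ [0,T]` and all `k`
(`‖c_∞ - Φ(w)‖ ≤ ‖c_∞ - cₙ₊₁‖ + ‖Φ(wₙ) - Φ(w)‖ ≤ R(1/2)^{n+1} + R(1/2)^{n+1} → 0`).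
[cite: Pazy1983, Ch. 6 §6.1 Thm. 1.2 (proof: Picard iteration), p. 184] -/
theorem limFamily_eq_picardMap {t : ℝ} (ht : t ∈ Icc 0 Q.T) (k : d → ℤ) :
    Q.limFamily t k = Q.picardMap Q.limStage.synth t k := by
  refine eq_of_norm_sub_le_zero ?_
  refine ge_of_tendsto' Q.tendsto_R_mul_pow fun n => ?_
  have hδ : 0 ≤ Q.R * (1 / 2) ^ n := by have := Q.R_nonneg; positivity
  have hdiff : IsL2Field Q.T ((Q.R * (1 / 2) ^ n) ^ 2)
      (fun s x => (Q.stage n).synth s x - Q.limStage.synth s x) :=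
    (Q.stage n).isL2Field_synth.sub_of_coeff Q.limStage.isL2Field_synth
      (fun s hs k => (Q.stage n).mFourierCoeff_synth hs k)
      (fun s hs k => Q.limStage.mFourierCoeff_synth hs k) hδ (fun s hs G => by
        rw [l2F_sub_comm, limStage_coef]; exact Q.l2F_limFamily_sub_le n hs G)
  have e : (Q.stage (n + 1)).coef t k - Q.picardMap Q.limStage.synth t k =
      -(duhamelCoeff Q.κ Q.a Q.lam Q.u (fun s x => (Q.stage n).synth s x - Q.limStage.synth s x) t k) := by
    rw [Q.stage_succ_coef n, picardMap_apply, picardMap_apply,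
      duhamelCoeff_sub Q.hu (Q.stage n).isL2Field_synth Q.limStage.isL2Field_synth ht.2]
    ring
  have h2 : ‖(Q.stage (n + 1)).coef t k - Q.picardMap Q.limStage.synth t k‖ ≤ Q.R * (1 / 2) ^ n / 2 := by
    rw [e, norm_neg]
    exact (norm_le_l2F (Finset.mem_singleton_self k) _).trans (Q.l2F_duhamel_le_half hδ hdiff ht {k})
  have h1 : ‖Q.limFamily t k - (Q.stage (n + 1)).coef t k‖ ≤ Q.R * (1 / 2) ^ (n + 1) :=
    (norm_le_l2F (Finset.mem_singleton_self k) _).trans (Q.l2F_limFamily_sub_le (n + 1) ht {k})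
  calc ‖Q.limFamily t k - Q.picardMap Q.limStage.synth t k‖
      ≤ ‖Q.limFamily t k - (Q.stage (n + 1)).coef t k‖ +
          ‖(Q.stage (n + 1)).coef t k - Q.picardMap Q.limStage.synth t k‖ :=
        norm_sub_le_norm_sub_add_norm_sub _ _ _
    _ ≤ Q.R * (1 / 2) ^ (n + 1) + Q.R * (1 / 2) ^ n / 2 := add_le_add h1 h2
    _ = Q.R * (1 / 2) ^ n := by ring

/-- **Existence of a fixed point** (summary of the Picard iteration): a jointly measurable real
field `w` on `(0,T) × T^d` with `∫ w(t)² ≤ B² = 4A²` at every `t ∈ [0,T]`, whose Fourier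
coefficients are continuous in `t`, and satisfy the damped mild equation with free term `f`,
`𝓕(w(t))(k) = f(t)(k) - ∫_{(0,t]} e^{-(νₖ+λ)(t-s)} N(w)(s)(k) ds` on `[0,T]`
(Pazy 1983, Ch. 4 Def. 2.3 / Cor. 2.5 with Ch. 6 Thm. 1.2's iteration). [cite: Pazy1983, Ch. 6 §6.1 Thm. 1.2 (proof: Picard iteration), p. 184] -/
theorem exists_fixedPoint :
    ∃ w : ℝ → UnitAddTorus d → ℝ, IsL2Field Q.T (Q.R ^ 2) w ∧
      (∀ k, ContinuousOn (fun t => mFourierCoeff (fun x => (w t x : ℂ)) k) (Icc 0 Q.T)) ∧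
      ∀ t ∈ Icc 0 Q.T, ∀ k,
        mFourierCoeff (fun x => (w t x : ℂ)) k = Q.f t k - duhamelCoeff Q.κ Q.a Q.lam Q.u w t k := by
  refine ⟨Q.limStage.synth, Q.limStage.isL2Field_synth, fun k => ?_, fun t ht k => ?_⟩
  · exact (Q.continuousOn_limFamily k).congr fun t ht => Q.limStage.mFourierCoeff_synth ht k
  · rw [Q.limStage.mFourierCoeff_synth ht k, limStage_coef]
    exact Q.limFamily_eq_picardMap ht k

end PicardData

end Picard

end Torus

end Literature.Analysis.FluidPDE

end
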